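import Mathlib
import HarnessLib
import Literature.MathematicalPhysics.StatisticalMechanics.InitialActivityHamiltonian
import Literature.MathematicalPhysics.StatisticalMechanics.TuningMapOfHamiltonian
import Literature.MathematicalPhysics.StatisticalMechanics.LatticeSobolevLine

/-!
# The perturbed integrand with a relevant seed: `e^{½Σ_x⟨q(ℋ)∇φ(x),∇φ(x)⟩} ∏_x(1+𝒦(∇φ(x))) =`
# `e^{λ|Λ|} (e^{−ℋ} ∘ K̂_0(𝒦,ℋ))(Λ, φ)` ([ABKM19] Ch. 4.2 (4.6)–(4.8), Ch. 12.1 (12.8))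

[ABKM19] starts the renormalisation group of Ch. 12 from the representation of the perturbed
integrand `F(φ) = ∏_{x∈Λ}(1 + 𝒦(∇φ(x)))` relative to the Gaussian `μ^{(q)}`, `q = q(ℋ)`: for a relevant
Hamiltonian `ℋ ∈ M_0` with constant coefficient `λ`, linear coefficients `a_α` and quadratic coefficients
`a_{ij}` (`i ≤ j`),

* the linear monomials sum to zero over the torus, `Σ_{x∈Λ} ∇^αφ(x) = 0` (`sum_iterDiff_eq_zero`), so
  `ℋ(Λ, φ) = λ|Λ| + Σ_{i≤j} a_{ij} Σ_x ∇_iφ(x)∇_jφ(x)` (`eval_univ_eq`);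
* the quadratic form of the tuning matrix `q(ℋ)` (`hamQuadForm`: `q_{ii} = −2Re a_{ii}`, `q_{ij} = −Re a_{ij}`)
  is `½⟨q(ℋ)z, z⟩ = −Σ_{i≤j} Re a_{ij} z_iz_j` (`quadForm_hamQuadForm`);
* at scale `0` the circle product telescopes: `(e^{−ℋ} ∘ K̂_0(𝒦,ℋ))(Λ, φ) = e^{−ℋ(Λ,φ)} ∏_x (1+𝒦(∇φ(x)))`
  (`pcirc_expNegH_initKH_univ`);
* hence, when the quadratic coefficients are REAL (the `ι`-symmetric class),
  **`exp_quadForm_smul_prod_eq`**: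
  `e^{½Σ_x⟨q(ℋ)∇φ(x),∇φ(x)⟩} • ∏_x(1+𝒦(∇φ(x))) = e^{λ|Λ|} · (e^{−ℋ} ∘ K̂_0(𝒦,ℋ))(Λ, φ)`.

Everything is proved; no named fact.  The Gaussian side (`μ^{(0)}` versus `μ^{(q)}`) is
`GaussianFormChange.integral_stepMeasure_eq_formChange`.

## References
* S. Adams, S. Buchholz, R. Kotecký, S. Müller, arXiv:1910.13564, Ch. 4.2 (4.6)–(4.8), Ch. 12.1 (12.8)
  [AdamsBuchholzKoteckyMuller2019].
-/

noncomputable section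

namespace Literature.MathematicalPhysics.StatisticalMechanics.GradientRG

open scoped BigOperators
open Finset
open Literature.MathematicalPhysics.StatisticalMechanics.GradientFRD (iterDiff)
open Literature.MathematicalPhysics.StatisticalMechanics.TorusPolymer (pcirc polys mem_polys)

variable {d M : ℕ} [NeZero M]

/-! ## Derivatives sum to zero over the torus -/

/-- `Σ_{x∈Λ} ∇_i g(x) = 0` on the torus. [cite: AdamsBuchholzKoteckyMuller2019, Ch. 4.2 (4.6)] -/
theorem sum_fwdDiff_eq_zero (i : Fin d) (g : (Fin d → ZMod M) → ℝ) :
    ∑ x, GradientFRD.fwdDiff i g x = 0 := by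
  simp only [GradientFRD.fwdDiff, Finset.sum_sub_distrib]
  rw [show ∑ x : Fin d → ZMod M, g (x + Pi.single i 1) = ∑ x, g x from
    Fintype.sum_equiv (Equiv.addRight (Pi.single i (1 : ZMod M))) _ _ (fun x => rfl), sub_self]

/-- **`Σ_{x∈Λ} ∇^αφ(x) = 0`** for `|α| ≥ 1`: the linear relevant monomials have zero torus sum.
[cite: AdamsBuchholzKoteckyMuller2019, Ch. 4.2 (4.6)] -/
theorem sum_iterDiff_eq_zero {α : Fin d → ℕ} (hα : 1 ≤ ∑ i, α i) (φ : (Fin d → ZMod M) → ℝ) :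
    ∑ x, iterDiff α φ x = 0 := by
  obtain ⟨i, -, hi⟩ : ∃ i ∈ (Finset.univ : Finset (Fin d)), α i ≠ 0 :=
    Finset.exists_ne_zero_of_sum_ne_zero (by omega)
  set β : Fin d → ℕ := α - Pi.single i 1 with hβ
  have hαβ : α = β + Pi.single i 1 := by
    funext j
    simp only [hβ, Pi.add_apply, Pi.sub_apply, Pi.single_apply]
    split_ifs with h
    · subst h; omega
    · omega
  rw [hαβ, iterDiff_add_single]
  exact sum_fwdDiff_eq_zero i _

/-! ## `ℋ(Λ, φ)`: only the constant and the quadratic monomials survive -/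

section Eval

variable {𝕜 : Type*} [CommRing 𝕜] [Algebra ℝ 𝕜]

/-- **`ℋ(Λ, φ) = λ|Λ| + Σ_{i≤j} a_{ij} Σ_x ∇_iφ(x)∇_jφ(x)`** — over the whole torus the linear monomials
drop out. [cite: AdamsBuchholzKoteckyMuller2019, Ch. 4.2 (4.6)–(4.8)] -/
theorem eval_univ_eq (H : RelevantHamiltonian 𝕜 d) (φ : (Fin d → ZMod M) → ℝ) :
    eval H Finset.univ φ =
      (Fintype.card (Fin d → ZMod M) : ℝ) • H (Sum.inl ()) +
        ∑ p : quadIndex d, (∑ x, GradientFRD.fwdDiff p.1.1 φ x * GradientFRD.fwdDiff p.1.2 φ x) •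
          H (Sum.inr (Sum.inr p)) := by
  unfold eval density
  rw [Finset.sum_comm]
  simp only [← Finset.sum_smul]
  rw [Fintype.sum_sum_type, Fintype.sum_sum_type]
  have hlin : ∑ α : linIndex d, (∑ x : Fin d → ZMod M, relMonomial (Sum.inr (Sum.inl α)) φ x) •
      H (Sum.inr (Sum.inl α)) = 0 := by
    refine Finset.sum_eq_zero fun α _ => ?_
    have h := sum_iterDiff_eq_zero (M := M) (mem_linIndex.1 α.2).1 φ
    simp only [relMonomial_lin, h, zero_smul]
  rw [hlin, zero_add]
  congr 1
  simp

end Eval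

/-! ## The quadratic form of the tuning matrix `q(ℋ)` -/

/-- Entrywise: `q(ℋ)_{ij} = −Σ_{p=(k≤l)} ([p=(i,j)] + [p=(j,i)]) Re a_p`.
[cite: AdamsBuchholzKoteckyMuller2019, Ch. 12.1 (12.8)–(12.11)] -/
theorem hamQuadForm_eq_sum (H : RelevantHamiltonian ℂ d) (i j : Fin d) :
    hamQuadForm H i j = ∑ p : quadIndex d,
      -(((if p.1 = (i, j) then (1 : ℝ) else 0) + (if p.1 = (j, i) then (1 : ℝ) else 0)) *
        (H (Sum.inr (Sum.inr p))).re) := by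
  classical
  have key : ∀ (a b : Fin d) (hab : a ≤ b),
      ∑ p : quadIndex d, (if p.1 = (a, b) then (1 : ℝ) else 0) * (H (Sum.inr (Sum.inr p))).re =
        (H (Sum.inr (Sum.inr ⟨(a, b), hab⟩))).re := by
    intro a b hab
    rw [Finset.sum_eq_single ⟨(a, b), hab⟩]
    · simp
    · intro p _ hp
      have : p.1 ≠ (a, b) := fun h => hp (Subtype.ext h)
      simp [this]
    · intro h; exact absurd (Finset.mem_univ _) h
  have key0 : ∀ (a b : Fin d), ¬ a ≤ b →
      ∑ p : quadIndex d, (if p.1 = (a, b) then (1 : ℝ) else 0) * (H (Sum.inr (Sum.inr p))).re = 0 := by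
    intro a b hab
    refine Finset.sum_eq_zero fun p _ => ?_
    have : p.1 ≠ (a, b) := fun h => hab (by have := p.2; rw [h] at this; exact this)
    simp [this]
  simp only [Finset.sum_neg_distrib, add_mul, Finset.sum_add_distrib]
  unfold hamQuadForm
  by_cases hij : i ≤ j
  · by_cases hji : j ≤ i
    · have heq : i = j := le_antisymm hij hji
      subst heq
      rw [dif_pos hij, if_pos rfl, key i i hij]
      ring
    · rw [dif_pos hij, if_neg (fun h => hji (le_of_eq h.symm)), key i j hij, key0 j i hji]
      ring
  · have hji : j ≤ i := le_of_not_ge hij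
    rw [dif_neg hij, key0 i j hij, key j i hji]
    ring

/-- **`Σ_{ij} q(ℋ)_{ij} z_i z_j = −2 Σ_{i≤j} Re a_{ij} z_i z_j`.**
[cite: AdamsBuchholzKoteckyMuller2019, Ch. 12.1 (12.8)–(12.11)] -/
theorem quadForm_hamQuadForm (H : RelevantHamiltonian ℂ d) (z : Fin d → ℝ) :
    ∑ i, ∑ j, hamQuadForm H i j * z i * z j =
      -2 * ∑ p : quadIndex d, (H (Sum.inr (Sum.inr p))).re * (z p.1.1 * z p.1.2) := by
  classical
  set c : quadIndex d → Fin d → Fin d → ℝ := fun p i j =>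
    -(((if p.1 = (i, j) then (1 : ℝ) else 0) + (if p.1 = (j, i) then (1 : ℝ) else 0)) *
      (H (Sum.inr (Sum.inr p))).re) with hc
  have hL : ∑ i, ∑ j, hamQuadForm H i j * z i * z j = ∑ p : quadIndex d, ∑ i, ∑ j, c p i j * z i * z j := by
    have h1 : ∀ i j, hamQuadForm H i j * z i * z j = ∑ p : quadIndex d, c p i j * z i * z j := by
      intro i j
      rw [hamQuadForm_eq_sum, Finset.sum_mul, Finset.sum_mul]
    simp_rw [h1]
    rw [Finset.sum_congr rfl fun i _ => Finset.sum_comm, Finset.sum_comm]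
  rw [hL, Finset.mul_sum]
  refine Finset.sum_congr rfl fun p _ => ?_
  have h1 : ∑ i : Fin d, ∑ j : Fin d, (if p.1 = (i, j) then (1 : ℝ) else 0) * z i * z j = z p.1.1 * z p.1.2 := by
    rw [Finset.sum_eq_single p.1.1, Finset.sum_eq_single p.1.2]
    · simp
    · intro j _ hj
      have : p.1 ≠ (p.1.1, j) := fun h => hj (by rw [Prod.ext_iff] at h; exact h.2.symm)
      simp [this]
    · intro h; exact absurd (Finset.mem_univ _) h
    · intro i _ hi
      refine Finset.sum_eq_zero fun j _ => ?_
      have : p.1 ≠ (i, j) := fun h => hi (by rw [Prod.ext_iff] at h; exact h.1.symm)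
      simp [this]
    · intro h; exact absurd (Finset.mem_univ _) h
  have h2 : ∑ i : Fin d, ∑ j : Fin d, (if p.1 = (j, i) then (1 : ℝ) else 0) * z i * z j = z p.1.1 * z p.1.2 := by
    rw [Finset.sum_comm]
    have : ∀ i j : Fin d, (if p.1 = (i, j) then (1 : ℝ) else 0) * z j * z i =
        (if p.1 = (i, j) then (1 : ℝ) else 0) * z i * z j := fun i j => by ring
    simp_rw [this]
    exact h1
  have hsum : ∑ i : Fin d, ∑ j : Fin d, c p i j * z i * z j =
      -(H (Sum.inr (Sum.inr p))).re * (∑ i : Fin d, ∑ j : Fin d, (if p.1 = (i, j) then (1 : ℝ) else 0) * z i * z j +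
        ∑ i : Fin d, ∑ j : Fin d, (if p.1 = (j, i) then (1 : ℝ) else 0) * z i * z j) := by
    rw [mul_add, Finset.mul_sum, Finset.mul_sum, ← Finset.sum_add_distrib]
    refine Finset.sum_congr rfl fun i _ => ?_
    rw [Finset.mul_sum, Finset.mul_sum, ← Finset.sum_add_distrib]
    refine Finset.sum_congr rfl fun j _ => ?_
    simp only [hc]
    ring
  rw [hsum, h1, h2]
  ring

/-- **`½ Σ_x Σ_{ij} q(ℋ)_{ij} ∇_iφ(x)∇_jφ(x) = −Σ_{i≤j} Re a_{ij} Σ_x ∇_iφ(x)∇_jφ(x)`.**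
[cite: AdamsBuchholzKoteckyMuller2019, Ch. 4.2 (4.6)–(4.8)] -/
theorem half_sum_quadForm_hamQuadForm (H : RelevantHamiltonian ℂ d) (φ : (Fin d → ZMod M) → ℝ) :
    (∑ x, ∑ i, ∑ j, hamQuadForm H i j * GradientFRD.fwdDiff i φ x * GradientFRD.fwdDiff j φ x) / 2 =
      -∑ p : quadIndex d, (H (Sum.inr (Sum.inr p))).re *
        ∑ x, GradientFRD.fwdDiff p.1.1 φ x * GradientFRD.fwdDiff p.1.2 φ x := by
  have h : ∀ x, ∑ i, ∑ j, hamQuadForm H i j * GradientFRD.fwdDiff i φ x * GradientFRD.fwdDiff j φ x =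
      -2 * ∑ p : quadIndex d, (H (Sum.inr (Sum.inr p))).re *
        (GradientFRD.fwdDiff p.1.1 φ x * GradientFRD.fwdDiff p.1.2 φ x) :=
    fun x => quadForm_hamQuadForm H (fun i => GradientFRD.fwdDiff i φ x)
  simp_rw [h]
  rw [← Finset.mul_sum, Finset.sum_comm]
  simp_rw [← Finset.mul_sum]
  ring

/-! ## The circle product at scale `0` with a relevant seed -/

/-- **`(e^{−ℋ} ∘ K̂_0(𝒦,ℋ))(Λ, φ) = e^{−ℋ(Λ,φ)} ∏_x (1 + 𝒦(∇φ(x)))`**: the Boltzmann factors of `Y` and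
`Λ ∖ Y` recombine (`ℋ(Y) + ℋ(Λ∖Y) = ℋ(Λ)`), leaving the polymer expansion of the product.
[cite: AdamsBuchholzKoteckyMuller2019, Ch. 4.2 (4.6)–(4.8), Ch. 12.1 (12.8)] -/
theorem pcirc_expNegH_initKH_univ (𝒦 : (Fin d → ℝ) → ℂ) (H : RelevantHamiltonian ℂ d)
    (φ : (Fin d → ZMod M) → ℝ) :
    pcirc 1 (fun V => expNegH H V φ) (fun U => initKH 𝒦 H U φ) univ =
      expNegH H univ φ * ∏ x : Fin d → ZMod M, (1 + 𝒦 (gradAt x φ)) := by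
  rw [prod_one_add_eq_pcirc_initK]
  unfold pcirc
  rw [Finset.mul_sum]
  refine Finset.sum_congr rfl fun Y hY => ?_
  have hYsub : Y ⊆ univ := Finset.subset_univ Y
  have hdisj : Disjoint Y (univ \ Y) := Finset.disjoint_sdiff
  have hunion : Y ∪ (univ \ Y) = univ := Finset.union_sdiff_of_subset hYsub
  dsimp only
  rw [initKH_apply, expNegH_zero, one_mul, ← mul_assoc]
  congr 1
  simp only [expNegH]
  rw [← Complex.exp_add, ← neg_add, ← eval_union H hdisj, hunion]

/-- **The perturbed integrand relative to `μ^{(q(ℋ))}`** ([ABKM19] (4.6)–(4.8) with (12.8)): for a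
relevant Hamiltonian with REAL quadratic coefficients,
`e^{½Σ_x⟨q(ℋ)∇φ(x),∇φ(x)⟩} • ∏_x(1+𝒦(∇φ(x))) = e^{λ|Λ|} · (e^{−ℋ} ∘ K̂_0(𝒦,ℋ))(Λ, φ)`.
[cite: AdamsBuchholzKoteckyMuller2019, Ch. 4.2 (4.6)–(4.8), Ch. 12.1 (12.8)] -/
theorem exp_quadForm_smul_prod_eq (𝒦 : (Fin d → ℝ) → ℂ) {H : RelevantHamiltonian ℂ d}
    (hq : ∀ p : quadIndex d, ((H (Sum.inr (Sum.inr p))).re : ℂ) = H (Sum.inr (Sum.inr p)))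
    (φ : (Fin d → ZMod M) → ℝ) :
    Real.exp ((∑ x, ∑ i, ∑ j, hamQuadForm H i j * GradientFRD.fwdDiff i φ x * GradientFRD.fwdDiff j φ x) / 2) •
        ∏ x : Fin d → ZMod M, (1 + 𝒦 (gradAt x φ)) =
      Complex.exp ((Fintype.card (Fin d → ZMod M) : ℂ) * H (Sum.inl ())) *
        pcirc 1 (fun V => expNegH H V φ) (fun U => initKH 𝒦 H U φ) univ := by
  rw [pcirc_expNegH_initKH_univ, ← mul_assoc, Complex.real_smul]
  congr 1
  rw [half_sum_quadForm_hamQuadForm, Complex.ofReal_exp]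
  simp only [expNegH]
  rw [← Complex.exp_add, eval_univ_eq]
  congr 1
  have hquad : ∑ p : quadIndex d,
      (∑ x, GradientFRD.fwdDiff p.1.1 φ x * GradientFRD.fwdDiff p.1.2 φ x) • H (Sum.inr (Sum.inr p)) =
      ∑ p : quadIndex d, (((H (Sum.inr (Sum.inr p))).re *
        ∑ x, GradientFRD.fwdDiff p.1.1 φ x * GradientFRD.fwdDiff p.1.2 φ x : ℝ) : ℂ) := by
    refine Finset.sum_congr rfl fun p _ => ?_
    rw [Complex.real_smul, Complex.ofReal_mul, hq p, mul_comm]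
  rw [hquad, Complex.real_smul, Complex.ofReal_natCast, ← Complex.ofReal_sum]
  push_cast
  ring

end Literature.MathematicalPhysics.StatisticalMechanics.GradientRG

end
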